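import Literature.Topology.FourManifolds.SimplifiedBrokenLefschetzFibrationProofs
import Literature.Topology.FourManifolds.MorseChartChange
import Literature.Topology.FourManifolds.TrisectionsRadialThickening
import Literature.Topology.FourManifolds.LatticeFormsOrthoSumSignature
import Mathlib.LinearAlgebra.QuadraticForm.Signature
import HarnessLib

/-!
# Hessians of a height function composed with a broken Lefschetz fibration, in the fold and
# node charts

Topic `Literature/Topology/FourManifolds`; groundwork for the Euler count
`card_eq_four_mul_of_sblf_of_homotopyEquiv_sphere_four` (Baykur 2012, Lemma 7:
*"`e(X) = 6 - 4g + k`"*) of `SimplifiedBrokenLefschetzFibration.lean`, whose Morse-theoretic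
reading composes the fibration `f : X → S²` with a height function `ℓ : S² → ℝ` and counts the
critical points of `g = ℓ ∘ f` on a slab between the two pole fibres: the Lefschetz points (index
`2`) and the points of the round locus where `ℓ` restricted to the round image is critical.
Everything here is **proved**; there are no definitions and no named facts.

* Model calculus on `ℝ⁴`.  For the indefinite fold normal form
  `N (t, x₁, x₂, x₃) = (t, x₁² + x₂² - x₃²)` (Hayano 2011, Def. 2.1 (4)) and a `C²` function `Λ`
  of two variables: the first and second derivatives of `N` (`fderiv_foldNormalForm_apply_eq`,
  `fderiv_fderiv_foldNormalForm_apply`), the derivative and the Hessian of `Λ ∘ N` at a point of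
  the axis (`fderiv_comp_foldNormalForm_apply`, `fderiv_fderiv_comp_foldNormalForm_apply`:
  `D²(Λ ∘ N)(v, w) = ∂ₜₜΛ v₀ w₀ + 2 ∂ₛΛ (v₁ w₁ + v₂ w₂ - v₃ w₃)`), and the negative index of
  inertia and nondegeneracy of the diagonal form `α v₀ w₀ + 2β (v₁ w₁ + v₂ w₂ - v₃ w₃)`
  (`sigNeg_of_forall_apply_eq_foldForm`, `nondegenerate_iff_of_forall_apply_eq_foldForm`): index
  `[α < 0] + 1` if `β > 0`, `[α < 0] + 2` if `β < 0`.
* The node `(z₁, z₂) ↦ z₁ z₂` (`lefschetzNodeMap`): its second derivative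
  (`fderiv_fderiv_lefschetzNodeMap_apply`), the Hessian of `Λ ∘ node` at the origin
  (`fderiv_fderiv_comp_lefschetzNodeMap_apply`), and for a real linear form `μ ≠ 0` on `ℂ` the
  form `μ (z₁(v) z₂(w) + z₁(w) z₂(v))` on `ℝ⁴` is nondegenerate of index `2`
  (`sigNeg_of_forall_apply_eq_nodeForm`, `nondegenerate_of_forall_apply_eq_nodeForm`).
* Manifold statements for `g = ℓ ∘ f` on a `C^∞` 4-manifold `X` (model `𝓡 4`), `f : X → S²`,
  `ℓ : S² → ℝ`: at a regular point of `f`, `g` is critical iff `dℓ = 0` at `f q`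
  (`isMCriticalPt_comp_iff_of_surjective_mfderiv`); in a fold chart (`hessianInChart_of_fold_chart`)
  the critical points on the axis (`isMCriticalPt_comp_iff_of_fold_chart`: iff `∂ₜ(ℓ ∘ ψ⁻¹) = 0`),
  their nondegeneracy and index (`nondegenerate_and_morseIndex_comp_of_fold_chart`); at a
  Lefschetz point `g` is critical, nondegenerate of index `2` as soon as `dℓ ≠ 0` at the critical
  value (`isMCriticalPt_nondegenerate_morseIndex_comp_of_lefschetzChart`) — Milnor 1963, §2 read in
  the charts of Gompf–Stipsicz 1999, Def. 8.1.4 and Hayano 2011, Def. 2.1, through the tree's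
  `hessianInChart` / `morseIndex_eq_sigNeg_hessianInChart` (`MorseChartChange.lean`).

## References

* R. İ. Baykur, *Broken Lefschetz fibrations and smooth structures on 4-manifolds*, Geom. Topol.
  Monogr. 18 (2012), Lemma 7. [Baykur2012]
* K. Hayano, *On genus-1 simplified broken Lefschetz fibrations*, Algebr. Geom. Topol. 11 (2011),
  Def. 2.1. [Hayano2011]
* J. Milnor, *Morse theory* (1963), §2. [Milnor1963]
-/

noncomputable section

open scoped Manifold ContDiff Topology
open Set Function

namespace Literature.Topology.FourManifolds

/-! ### Model calculus: the fold normal form and its second derivative -/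

section FoldModel

/-- Local notation: the indefinite fold normal form `(t, x₁, x₂, x₃) ↦ (t, x₁² + x₂² - x₃²)`. -/
local notation "foldNF" => (fun v : EuclideanSpace ℝ (Fin 4) =>
    (WithLp.toLp 2 ![v 0, v 1 ^ 2 + v 2 ^ 2 - v 3 ^ 2] : EuclideanSpace ℝ (Fin 2)))

/-- The differential of the fold normal form in vector form:
`dN_v w = w₀ e₀ + 2 (v₁ w₁ + v₂ w₂ - v₃ w₃) e₁`. [folklore] -/
theorem fderiv_foldNormalForm_apply_eq (v w : EuclideanSpace ℝ (Fin 4)) :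
    fderiv ℝ foldNF v w =
      (w 0) • EuclideanSpace.single (0 : Fin 2) (1 : ℝ) +
        (2 * (v 1 * w 1 + v 2 * w 2 - v 3 * w 3)) • EuclideanSpace.single (1 : Fin 2) (1 : ℝ) := by
  obtain ⟨h0, h1⟩ := fderiv_foldNormalForm_apply v w
  ext i
  fin_cases i
  · simp [h0]
  · simp [h1]

/-- The fold normal form is `C²` (indeed `C^∞`, `contDiff_foldNormalForm`). [folklore] -/
theorem contDiffAt_foldNormalForm_two (u : EuclideanSpace ℝ (Fin 4)) : ContDiffAt ℝ 2 foldNF u :=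
  (contDiff_foldNormalForm.of_le (by norm_cast)).contDiffAt

/-- **The second derivative of the fold normal form**:
`D²N_u (v, w) = 2 (v₁ w₁ + v₂ w₂ - v₃ w₃) e₁` (constant in `u`). [folklore] -/
theorem fderiv_fderiv_foldNormalForm_apply (u v w : EuclideanSpace ℝ (Fin 4)) :
    fderiv ℝ (fderiv ℝ foldNF) u v w =
      (2 * (v 1 * w 1 + v 2 * w 2 - v 3 * w 3)) • EuclideanSpace.single (1 : Fin 2) (1 : ℝ) := by
  set e₀ : EuclideanSpace ℝ (Fin 2) := EuclideanSpace.single (0 : Fin 2) (1 : ℝ) with he₀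
  set e₁ : EuclideanSpace ℝ (Fin 2) := EuclideanSpace.single (1 : Fin 2) (1 : ℝ) with he₁
  -- for fixed `w`, `y ↦ dN_y w = w₀ e₀ + (L_w y) e₁` with `L_w` linear
  let π : Fin 4 → (EuclideanSpace ℝ (Fin 4) →L[ℝ] ℝ) := fun i => EuclideanSpace.proj (𝕜 := ℝ) i
  set Lw : EuclideanSpace ℝ (Fin 4) →L[ℝ] ℝ :=
    (2 * w 1) • π 1 + (2 * w 2) • π 2 - (2 * w 3) • π 3 with hLw
  have hLw_apply : ∀ y : EuclideanSpace ℝ (Fin 4), Lw y = 2 * (y 1 * w 1 + y 2 * w 2 - y 3 * w 3) := by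
    intro y
    simp [hLw, π]
    ring
  have hfun : (fun y : EuclideanSpace ℝ (Fin 4) => fderiv ℝ foldNF y w) =
      fun y => (w 0) • e₀ + (Lw y) • e₁ := by
    funext y
    rw [fderiv_foldNormalForm_apply_eq, hLw_apply]
  have hderiv : HasFDerivAt (fun y : EuclideanSpace ℝ (Fin 4) => fderiv ℝ foldNF y w)
      (Lw.smulRight e₁) u := by
    rw [hfun]
    have h := (Lw.hasFDerivAt (x := u)).smul_const e₁
    exact h.const_add ((w 0) • e₀)
  -- evaluate `D²N_u v w` by differentiating `y ↦ dN_y w` in the direction `v`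
  have hc : DifferentiableAt ℝ (fderiv ℝ foldNF) u :=
    ((contDiff_foldNormalForm.fderiv_right (m := 1) (by norm_cast)).differentiable
      (by simp)).differentiableAt
  have hkey : fderiv ℝ (fun y : EuclideanSpace ℝ (Fin 4) => fderiv ℝ foldNF y w) u =
      (fderiv ℝ (fderiv ℝ foldNF) u).flip w := by
    rw [fderiv_clm_apply hc (differentiableAt_const w)]
    simp
  have h1 : fderiv ℝ (fderiv ℝ foldNF) u v w =
      fderiv ℝ (fun y : EuclideanSpace ℝ (Fin 4) => fderiv ℝ foldNF y w) u v := by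
    rw [hkey]
    rfl
  rw [h1, hderiv.fderiv, ContinuousLinearMap.smulRight_apply, hLw_apply]

/-- **First derivative of `Λ ∘ N` on the axis.**  At a point `u` of the `t`-axis
(`u₁ = u₂ = u₃ = 0`), `D(Λ ∘ N)_u w = w₀ · DΛ_{N u} e₀`: only the `t`-derivative of `Λ` survives.
[folklore] -/
theorem fderiv_comp_foldNormalForm_apply {Λ : EuclideanSpace ℝ (Fin 2) → ℝ} {u : EuclideanSpace ℝ (Fin 4)}
    (hΛ : DifferentiableAt ℝ Λ (foldNF u)) (hu : u 1 = 0 ∧ u 2 = 0 ∧ u 3 = 0)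
    (w : EuclideanSpace ℝ (Fin 4)) :
    fderiv ℝ (Λ ∘ foldNF) u w =
      w 0 * fderiv ℝ Λ (foldNF u) (EuclideanSpace.single (0 : Fin 2) (1 : ℝ)) := by
  have hN : DifferentiableAt ℝ foldNF u := (contDiffAt_foldNormalForm_two u).differentiableAt (by simp)
  rw [fderiv_comp u hΛ hN, ContinuousLinearMap.coe_comp, Function.comp_apply,
    fderiv_foldNormalForm_apply_eq]
  obtain ⟨h1, h2, h3⟩ := hu
  have hc0 : 2 * (u 1 * w 1 + u 2 * w 2 - u 3 * w 3) = 0 := by rw [h1, h2, h3]; ring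
  rw [hc0, zero_smul, add_zero, map_smul, smul_eq_mul]

/-- **The Hessian of `Λ ∘ N` on the axis** (second-order chain rule, Milnor 1963, §2): if `u`
lies on the `t`-axis then
`D²(Λ ∘ N)_u (v, w) = D²Λ_{N u}(e₀, e₀) v₀ w₀ + 2 DΛ_{N u}(e₁) (v₁ w₁ + v₂ w₂ - v₃ w₃)`
(on the axis `dN = dt ⊗ e₀` and `D²N = 2 (dx₁² + dx₂² - dx₃²) ⊗ e₁`; no criticality is needed).
[cite: Milnor1963, §2] -/
theorem fderiv_fderiv_comp_foldNormalForm_apply {Λ : EuclideanSpace ℝ (Fin 2) → ℝ}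
    {u : EuclideanSpace ℝ (Fin 4)} (hΛ : ContDiffAt ℝ 2 Λ (foldNF u))
    (hu : u 1 = 0 ∧ u 2 = 0 ∧ u 3 = 0) (v w : EuclideanSpace ℝ (Fin 4)) :
    fderiv ℝ (fderiv ℝ (Λ ∘ foldNF)) u v w =
      fderiv ℝ (fderiv ℝ Λ) (foldNF u) (EuclideanSpace.single (0 : Fin 2) (1 : ℝ))
          (EuclideanSpace.single (0 : Fin 2) (1 : ℝ)) * (v 0 * w 0) +
        fderiv ℝ Λ (foldNF u) (EuclideanSpace.single (1 : Fin 2) (1 : ℝ)) *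
          (2 * (v 1 * w 1 + v 2 * w 2 - v 3 * w 3)) := by
  rw [fderiv_fderiv_comp_apply (F := Λ) (τ := foldNF) (u₀ := u) hΛ (contDiffAt_foldNormalForm_two u) v w,
    fderiv_fderiv_foldNormalForm_apply, fderiv_foldNormalForm_apply_eq, fderiv_foldNormalForm_apply_eq]
  obtain ⟨h1, h2, h3⟩ := hu
  have hv0 : 2 * (u 1 * v 1 + u 2 * v 2 - u 3 * v 3) = 0 := by rw [h1, h2, h3]; ring
  have hw0 : 2 * (u 1 * w 1 + u 2 * w 2 - u 3 * w 3) = 0 := by rw [h1, h2, h3]; ring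
  rw [hv0, hw0]
  simp only [zero_smul, add_zero, map_smul, smul_eq_mul, smul_apply]
  ring

end FoldModel

/-! ### The diagonal form `α v₀ w₀ + 2β (v₁ w₁ + v₂ w₂ - v₃ w₃)`: index and nondegeneracy -/

section FoldForm

/-- **Negative index of inertia of the fold Hessian form.**  For `α ≠ 0`, `β ≠ 0` the symmetric
bilinear form `B (v, w) = α v₀ w₀ + 2β (v₁ w₁ + v₂ w₂ - v₃ w₃)` on `ℝ⁴` — the Hessian of a
height function composed with the fold `(t, x) ↦ (t, x₁² + x₂² - x₃²)` at a critical point of the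
axis — has `sigNeg B = [α < 0] + 1` if `β > 0` and `[α < 0] + 2` if `β < 0` (count the negative
entries of the diagonal `(α, 2β, 2β, -2β)`; Sylvester's law, Milnor 1963, §2). [cite: Milnor1963, §2] -/
theorem sigNeg_of_forall_apply_eq_foldForm (B : LinearMap.BilinForm ℝ (EuclideanSpace ℝ (Fin 4)))
    {α β : ℝ} (hα : α ≠ 0) (hβ : β ≠ 0)
    (hB : ∀ v w, B v w = α * (v 0 * w 0) + β * (2 * (v 1 * w 1 + v 2 * w 2 - v 3 * w 3))) :
    sigNeg B.toQuadraticMap = (if α < 0 then 1 else 0) + (if 0 < β then 1 else 2) := by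
  classical
  -- the standard basis is `B`-orthogonal with squares `α, 2β, 2β, -2β`
  set d : Fin 4 → ℝ := ![α, 2 * β, 2 * β, -(2 * β)] with hd
  have hdiag : ∀ i : Fin 4, B (EuclideanSpace.single i (1 : ℝ)) (EuclideanSpace.single i (1 : ℝ)) = d i := by
    intro i
    rw [hB]
    fin_cases i <;> simp [hd] <;> ring
  have horth : Pairwise fun i j : Fin 4 =>
      B (EuclideanSpace.single i (1 : ℝ)) (EuclideanSpace.single j (1 : ℝ)) = 0 := by
    intro i j hij
    rw [hB]
    fin_cases i <;> fin_cases j <;> simp_all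
  have h0 : ∀ i : Fin 4, B (EuclideanSpace.single i (1 : ℝ)) (EuclideanSpace.single i (1 : ℝ)) ≠ 0 := by
    intro i
    rw [hdiag]
    fin_cases i <;> simp [hd, hα, hβ]
  have hcard : Fintype.card (Fin 4) = Module.finrank ℝ (EuclideanSpace ℝ (Fin 4)) := by simp
  obtain ⟨-, hneg⟩ := LinearMap.BilinForm.sigPos_eq_card_of_orthogonal B (fun i : Fin 4 => EuclideanSpace.single i (1 : ℝ))
    horth h0 hcard
  rw [hneg]
  simp_rw [hdiag]
  -- count the negative diagonal entries
  rw [Fintype.card_subtype]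
  have huniv : (Finset.univ : Finset (Fin 4)) = {0, 1, 2, 3} := by decide
  rw [huniv]
  rcases lt_or_gt_of_ne hα with hα' | hα' <;> rcases lt_or_gt_of_ne hβ with hβ' | hβ'
  · have hb1 : 2 * β < 0 := by linarith
    have hb2 : ¬ (-(2 * β) < 0) := by linarith
    have hb3 : ¬ (0 : ℝ) < β := not_lt.2 hβ'.le
    simp [Finset.filter_insert, Finset.filter_singleton, hd, hα', hb1, hb2, hb3]
  · have hb1 : ¬ 2 * β < 0 := by linarith
    have hb2 : -(2 * β) < 0 := by linarith
    simp [Finset.filter_insert, Finset.filter_singleton, hd, hα', hb1, hb2, hβ']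
  · have h1 : ¬ α < 0 := not_lt.2 hα'.le
    have hb1 : 2 * β < 0 := by linarith
    have hb2 : ¬ (-(2 * β) < 0) := by linarith
    have hb3 : ¬ (0 : ℝ) < β := not_lt.2 hβ'.le
    simp [Finset.filter_insert, Finset.filter_singleton, hd, h1, hb1, hb2, hb3]
  · have h1 : ¬ α < 0 := not_lt.2 hα'.le
    have hb1 : ¬ 2 * β < 0 := by linarith
    have hb2 : -(2 * β) < 0 := by linarith
    simp [Finset.filter_insert, Finset.filter_singleton, hd, h1, hb1, hb2, hβ']

/-- **Nondegeneracy of the fold Hessian form**: `B (v, w) = α v₀ w₀ + 2β (v₁ w₁ + v₂ w₂ - v₃ w₃)`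
is nondegenerate iff `α ≠ 0` and `β ≠ 0`. [folklore] -/
theorem nondegenerate_iff_of_forall_apply_eq_foldForm
    (B : LinearMap.BilinForm ℝ (EuclideanSpace ℝ (Fin 4))) {α β : ℝ}
    (hB : ∀ v w, B v w = α * (v 0 * w 0) + β * (2 * (v 1 * w 1 + v 2 * w 2 - v 3 * w 3))) :
    B.Nondegenerate ↔ α ≠ 0 ∧ β ≠ 0 := by
  constructor
  · rintro ⟨hl, -⟩
    constructor
    · intro hα
      have := hl (EuclideanSpace.single (0 : Fin 4) (1 : ℝ)) (fun w => by rw [hB]; simp [hα])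
      have h := congrArg (fun v : EuclideanSpace ℝ (Fin 4) => v 0) this
      simp at h
    · intro hβ
      have := hl (EuclideanSpace.single (1 : Fin 4) (1 : ℝ)) (fun w => by rw [hB]; simp [hβ])
      have h := congrArg (fun v : EuclideanSpace ℝ (Fin 4) => v 1) this
      simp at h
  · rintro ⟨hα, hβ⟩
    have key : ∀ v : EuclideanSpace ℝ (Fin 4), (∀ w, B v w = 0) → v = 0 := by
      intro v hv
      have e0 := hv (EuclideanSpace.single (0 : Fin 4) (1 : ℝ))
      have e1 := hv (EuclideanSpace.single (1 : Fin 4) (1 : ℝ))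
      have e2 := hv (EuclideanSpace.single (2 : Fin 4) (1 : ℝ))
      have e3 := hv (EuclideanSpace.single (3 : Fin 4) (1 : ℝ))
      rw [hB] at e0 e1 e2 e3
      simp at e0 e1 e2 e3
      have hβ2 : (2 : ℝ) * β ≠ 0 := mul_ne_zero two_ne_zero hβ
      ext i
      fin_cases i
      · simpa [hα] using e0
      · rcases e1 with h | h
        · exact absurd h hβ
        · simpa using h
      · rcases e2 with h | h
        · exact absurd h hβ
        · simpa using h
      · rcases e3 with h | h
        · exact absurd h hβ
        · simpa using h
    have hsymm : ∀ v w, B v w = B w v := fun v w => by rw [hB, hB]; ring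
    exact ⟨fun v hv => key v hv, fun v hv => key v fun w => by rw [hsymm]; exact hv w⟩

end FoldForm

/-! ### Model calculus: the node `z₁ z₂` and its second derivative -/

section NodeModel

/-- **The second derivative of the node** `(z₁, z₂) ↦ z₁ z₂` on `ℝ⁴ = ℂ²`:
`D²(z₁ z₂)_x (v, w) = z₁(v) z₂(w) + z₁(w) z₂(v)` (constant in `x`). [folklore] -/
theorem fderiv_fderiv_lefschetzNodeMap_apply (x v w : EuclideanSpace ℝ (Fin 4)) :
    fderiv ℝ (fderiv ℝ lefschetzNodeMap) x v w =
      (⟨v 0, v 1⟩ : ℂ) * ⟨w 2, w 3⟩ + ⟨w 0, w 1⟩ * ⟨v 2, v 3⟩ := by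
  set z₁ : EuclideanSpace ℝ (Fin 4) →L[ℝ] ℂ :=
    Complex.equivRealProdCLM.symm.toContinuousLinearMap.comp
      ((EuclideanSpace.proj (𝕜 := ℝ) (0 : Fin 4)).prod (EuclideanSpace.proj (𝕜 := ℝ) (1 : Fin 4)))
    with hz₁
  set z₂ : EuclideanSpace ℝ (Fin 4) →L[ℝ] ℂ :=
    Complex.equivRealProdCLM.symm.toContinuousLinearMap.comp
      ((EuclideanSpace.proj (𝕜 := ℝ) (2 : Fin 4)).prod (EuclideanSpace.proj (𝕜 := ℝ) (3 : Fin 4)))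
    with hz₂
  have h1 : ∀ v, z₁ v = ⟨v 0, v 1⟩ := fun v ↦ by apply Complex.ext <;> simp [hz₁]
  have h2 : ∀ v, z₂ v = ⟨v 2, v 3⟩ := fun v ↦ by apply Complex.ext <;> simp [hz₂]
  -- for fixed `w`, `y ↦ d(z₁ z₂)_y w = z₂(w) z₁(y) + z₁(w) z₂(y)` is linear in `y`
  have hfun : (fun y : EuclideanSpace ℝ (Fin 4) => fderiv ℝ lefschetzNodeMap y w) =
      fun y => z₂ w * z₁ y + z₁ w * z₂ y := by
    funext y
    rw [fderiv_lefschetzNodeMap_apply, h1, h2, h1, h2]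
    ring
  have hderiv : HasFDerivAt (fun y : EuclideanSpace ℝ (Fin 4) => fderiv ℝ lefschetzNodeMap y w)
      (z₂ w • z₁ + z₁ w • z₂) x := by
    rw [hfun]
    exact ((z₁.hasFDerivAt (x := x)).const_mul (z₂ w)).add ((z₂.hasFDerivAt (x := x)).const_mul (z₁ w))
  have hc : DifferentiableAt ℝ (fderiv ℝ lefschetzNodeMap) x :=
    ((contDiff_lefschetzNodeMap.fderiv_right (m := 1) (by norm_cast)).differentiable
      (by simp)).differentiableAt
  have hkey : fderiv ℝ (fun y : EuclideanSpace ℝ (Fin 4) => fderiv ℝ lefschetzNodeMap y w) x =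
      (fderiv ℝ (fderiv ℝ lefschetzNodeMap) x).flip w := by
    rw [fderiv_clm_apply hc (differentiableAt_const w)]
    simp
  have h3 : fderiv ℝ (fderiv ℝ lefschetzNodeMap) x v w =
      fderiv ℝ (fun y : EuclideanSpace ℝ (Fin 4) => fderiv ℝ lefschetzNodeMap y w) x v := by
    rw [hkey]
    rfl
  rw [h3, hderiv.fderiv]
  simp only [add_apply, smul_apply, smul_eq_mul, h1, h2]
  ring

/-- **The Hessian of `Λ ∘ (z₁ z₂)` at the origin** (second-order chain rule at a critical point
of the inner map, Milnor 1963, §2): `D²(Λ ∘ node)_0 (v, w) = DΛ_0 (z₁(v) z₂(w) + z₁(w) z₂(v))`,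
since `d(z₁ z₂)_0 = 0`. [cite: Milnor1963, §2] -/
theorem fderiv_fderiv_comp_lefschetzNodeMap_apply {Λ : ℂ → ℝ}
    (hΛ : ContDiffAt ℝ 2 Λ (lefschetzNodeMap 0)) (v w : EuclideanSpace ℝ (Fin 4)) :
    fderiv ℝ (fderiv ℝ (Λ ∘ lefschetzNodeMap)) 0 v w =
      fderiv ℝ Λ 0 ((⟨v 0, v 1⟩ : ℂ) * ⟨w 2, w 3⟩ + ⟨w 0, w 1⟩ * ⟨v 2, v 3⟩) := by
  have hnode : ContDiffAt ℝ 2 lefschetzNodeMap 0 :=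
    (contDiff_lefschetzNodeMap.of_le (by norm_cast)).contDiffAt
  rw [fderiv_fderiv_comp_apply (F := Λ) (τ := lefschetzNodeMap) (u₀ := 0) hΛ hnode v w,
    fderiv_fderiv_lefschetzNodeMap_apply, hasFDerivAt_lefschetzNodeMap_zero.fderiv]
  simp

/-- A nonzero real linear form on `ℂ` does not vanish on a nonzero complex multiple of every
number: if `μ (η ζ) = 0` for all `ζ` then `η = 0`. [folklore] -/
theorem eq_zero_of_forall_apply_mul_eq_zero {μ : ℂ →L[ℝ] ℝ} (hμ : μ ≠ 0) {η : ℂ}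
    (h : ∀ ζ : ℂ, μ (η * ζ) = 0) : η = 0 := by
  by_contra hη
  apply hμ
  ext ζ
  have := h (η⁻¹ * ζ)
  rwa [← mul_assoc, mul_inv_cancel₀ hη, one_mul] at this

/-- A real linear form on `ℂ` in coordinates: `μ ζ = μ(1) Re ζ + μ(i) Im ζ`. [folklore] -/
theorem clm_complex_apply_eq (μ : ℂ →L[ℝ] ℝ) (ζ : ℂ) : μ ζ = μ 1 * ζ.re + μ Complex.I * ζ.im := by
  conv_lhs => rw [← Complex.re_add_im ζ]
  rw [map_add]
  have e1 : (ζ.re : ℂ) = ζ.re • (1 : ℂ) := by simp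
  have e2 : (ζ.im : ℂ) * Complex.I = ζ.im • Complex.I := by simp [Complex.real_smul]
  rw [e1, e2, map_smul, map_smul, smul_eq_mul, smul_eq_mul]
  ring

/-- **Negative index of inertia of the node Hessian form.**  For a nonzero real linear form `μ`
on `ℂ`, the symmetric bilinear form `B (v, w) = μ (z₁(v) z₂(w) + z₁(w) z₂(v))` on `ℝ⁴ = ℂ²` — the
Hessian at the origin of `μ ∘ (z₁ z₂)`, i.e. of a height function composed with the node — has
`sigNeg B = 2`: with `μ = a Re + b Im`, the vectors `(a + b i, ±1)`, `(-b + a i, ±i)` are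
`B`-orthogonal with squares `±2 (a² + b²)` (Milnor 1963, §2; the Lefschetz singularity has index
`2` for every height function regular at the critical value). [cite: Milnor1963, §2] -/
theorem sigNeg_of_forall_apply_eq_nodeForm (B : LinearMap.BilinForm ℝ (EuclideanSpace ℝ (Fin 4)))
    {μ : ℂ →L[ℝ] ℝ} (hμ : μ ≠ 0)
    (hB : ∀ v w, B v w = μ ((⟨v 0, v 1⟩ : ℂ) * ⟨w 2, w 3⟩ + ⟨w 0, w 1⟩ * ⟨v 2, v 3⟩)) :
    sigNeg B.toQuadraticMap = 2 := by
  classical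
  set a : ℝ := μ 1 with ha
  set b : ℝ := μ Complex.I with hb
  have hμ_apply : ∀ ζ : ℂ, μ ζ = a * ζ.re + b * ζ.im := clm_complex_apply_eq μ
  have hab : 0 < a ^ 2 + b ^ 2 := by
    by_contra hle
    have ha0 : a = 0 := by nlinarith [sq_nonneg a, sq_nonneg b]
    have hb0 : b = 0 := by nlinarith [sq_nonneg a, sq_nonneg b]
    apply hμ
    ext ζ
    rw [hμ_apply, ha0, hb0]
    simp
  -- the orthogonal family
  set f : Fin 4 → EuclideanSpace ℝ (Fin 4) :=
    ![WithLp.toLp 2 ![a, b, 1, 0], WithLp.toLp 2 ![a, b, -1, 0],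
      WithLp.toLp 2 ![-b, a, 0, 1], WithLp.toLp 2 ![-b, a, 0, -1]] with hf
  set d : Fin 4 → ℝ := ![2 * (a ^ 2 + b ^ 2), -(2 * (a ^ 2 + b ^ 2)), -(2 * (a ^ 2 + b ^ 2)),
    2 * (a ^ 2 + b ^ 2)] with hd
  have hdiag : ∀ i : Fin 4, B (f i) (f i) = d i := by
    intro i
    rw [hB, hμ_apply]
    fin_cases i <;> simp [hf, hd, Complex.mul_re, Complex.mul_im] <;> ring
  have horth : Pairwise fun i j : Fin 4 => B (f i) (f j) = 0 := by
    intro i j hij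
    rw [hB, hμ_apply]
    fin_cases i <;> fin_cases j <;> first | exact absurd rfl hij |
      (simp [hf, Complex.mul_re, Complex.mul_im] <;> ring)
  have h0 : ∀ i : Fin 4, B (f i) (f i) ≠ 0 := by
    intro i
    rw [hdiag]
    fin_cases i <;> simp [hd] <;> positivity
  have hcard : Fintype.card (Fin 4) = Module.finrank ℝ (EuclideanSpace ℝ (Fin 4)) := by simp
  obtain ⟨-, hneg⟩ := LinearMap.BilinForm.sigPos_eq_card_of_orthogonal B f horth h0 hcard
  rw [hneg]
  simp_rw [hdiag]
  rw [Fintype.card_subtype]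
  have huniv : (Finset.univ : Finset (Fin 4)) = {0, 1, 2, 3} := by decide
  rw [huniv]
  have hp : ¬ 2 * (a ^ 2 + b ^ 2) < 0 := by linarith
  have hn : -(2 * (a ^ 2 + b ^ 2)) < 0 := by linarith
  simp [Finset.filter_insert, Finset.filter_singleton, hd, hp, hn]

/-- **Nondegeneracy of the node Hessian form**: for `μ ≠ 0` the form
`B (v, w) = μ (z₁(v) z₂(w) + z₁(w) z₂(v))` is nondegenerate (test against vectors with `z₁ = 0`,
resp. `z₂ = 0`). [folklore] -/
theorem nondegenerate_of_forall_apply_eq_nodeForm (B : LinearMap.BilinForm ℝ (EuclideanSpace ℝ (Fin 4)))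
    {μ : ℂ →L[ℝ] ℝ} (hμ : μ ≠ 0)
    (hB : ∀ v w, B v w = μ ((⟨v 0, v 1⟩ : ℂ) * ⟨w 2, w 3⟩ + ⟨w 0, w 1⟩ * ⟨v 2, v 3⟩)) :
    B.Nondegenerate := by
  have hsymm : ∀ v w, B v w = B w v := fun v w => by rw [hB, hB, add_comm]
  have key : ∀ v : EuclideanSpace ℝ (Fin 4), (∀ w, B v w = 0) → v = 0 := by
    intro v hv
    -- `z₁(v) = 0`: test against `w = (0, ζ)`
    have hz1 : (⟨v 0, v 1⟩ : ℂ) = 0 := by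
      refine eq_zero_of_forall_apply_mul_eq_zero hμ fun ζ => ?_
      have := hv (WithLp.toLp 2 ![0, 0, ζ.re, ζ.im])
      rw [hB] at this
      simp at this
      rwa [show (⟨0, 0⟩ : ℂ) = 0 from rfl, zero_mul, map_zero, add_zero] at this
    -- `z₂(v) = 0`: test against `w = (ζ, 0)`
    have hz2 : (⟨v 2, v 3⟩ : ℂ) = 0 := by
      refine eq_zero_of_forall_apply_mul_eq_zero hμ fun ζ => ?_
      have := hv (WithLp.toLp 2 ![ζ.re, ζ.im, 0, 0])
      rw [hB] at this
      simp at this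
      rwa [show (⟨0, 0⟩ : ℂ) = 0 from rfl, mul_zero, map_zero, zero_add, mul_comm] at this
    rw [Complex.ext_iff] at hz1 hz2
    simp only [Complex.zero_re, Complex.zero_im] at hz1 hz2
    ext i
    fin_cases i
    · exact hz1.1
    · exact hz1.2
    · exact hz2.1
    · exact hz2.2
  exact ⟨fun v hv => key v hv, fun v hv => key v fun w => by rw [hsymm]; exact hv w⟩

end NodeModel

/-! ### Manifold statements: `g = ℓ ∘ f` at regular points, in fold charts, in Lefschetz charts -/

section Regular

variable {E H : Type*} [NormedAddCommGroup E] [NormedSpace ℝ E] [TopologicalSpace H]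
  {I : ModelWithCorners ℝ E H} {M : Type*} [TopologicalSpace M] [ChartedSpace H M]
  {E' H' : Type*} [NormedAddCommGroup E'] [NormedSpace ℝ E'] [TopologicalSpace H']
  {I' : ModelWithCorners ℝ E' H'} {N : Type*} [TopologicalSpace N] [ChartedSpace H' N]

/-- **Critical points of `ℓ ∘ f` at regular points of `f`.**  If `df_q` is onto then `q` is a
critical point of `ℓ ∘ f` iff `f q` is a critical point of `ℓ` (chain rule
`d(ℓ ∘ f)_q = dℓ_{f q} ∘ df_q`; Milnor 1963, §2). [cite: Milnor1963, §2] -/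
theorem isMCriticalPt_comp_iff_of_surjective_mfderiv {f : M → N} {ℓ : N → ℝ} {q : M}
    (hf : MDifferentiableAt I I' f q) (hℓ : MDifferentiableAt I' 𝓘(ℝ, ℝ) ℓ (f q))
    (hs : Surjective (mfderiv I I' f q)) :
    IsMCriticalPt I (ℓ ∘ f) q ↔ mfderiv I' 𝓘(ℝ, ℝ) ℓ (f q) = 0 := by
  unfold IsMCriticalPt
  rw [mfderiv_comp q hℓ hf]
  constructor
  · intro h
    ext y
    obtain ⟨v, rfl⟩ := hs y
    exact DFunLike.congr_fun h v
  · intro h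
    rw [h, ContinuousLinearMap.zero_comp]
    rfl

/-- In particular a regular point of `f` at whose value `ℓ` is regular is a regular point of
`ℓ ∘ f`. [cite: Milnor1963, §2] -/
theorem not_isMCriticalPt_comp_of_surjective_mfderiv {f : M → N} {ℓ : N → ℝ} {q : M}
    (hf : MDifferentiableAt I I' f q) (hℓ : MDifferentiableAt I' 𝓘(ℝ, ℝ) ℓ (f q))
    (hs : Surjective (mfderiv I I' f q)) (hℓq : mfderiv I' 𝓘(ℝ, ℝ) ℓ (f q) ≠ 0) :
    ¬ IsMCriticalPt I (ℓ ∘ f) q :=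
  fun h => hℓq ((isMCriticalPt_comp_iff_of_surjective_mfderiv hf hℓ hs).1 h)

end Regular

section FoldChart

variable {X : Type*} [TopologicalSpace X] [ChartedSpace (EuclideanSpace ℝ (Fin 4)) X]
  [IsManifold (𝓡 4) ∞ X]
  {f : X → Metric.sphere (0 : EuclideanSpace ℝ (Fin 3)) 1}
  {φ : OpenPartialHomeomorph X (EuclideanSpace ℝ (Fin 4))}
  {ψ : OpenPartialHomeomorph (Metric.sphere (0 : EuclideanSpace ℝ (Fin 3)) 1)
    (EuclideanSpace ℝ (Fin 2))}
  {ℓ : Metric.sphere (0 : EuclideanSpace ℝ (Fin 3)) 1 → ℝ}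

/-- Local notation: the indefinite fold normal form `(t, x₁, x₂, x₃) ↦ (t, x₁² + x₂² - x₃²)`. -/
local notation "foldNF" => (fun v : EuclideanSpace ℝ (Fin 4) =>
    (WithLp.toLp 2 ![v 0, v 1 ^ 2 + v 2 ^ 2 - v 3 ^ 2] : EuclideanSpace ℝ (Fin 2)))

omit [ChartedSpace (EuclideanSpace ℝ (Fin 4)) X] [IsManifold (𝓡 4) ∞ X] in
/-- In a fold chart, `ψ (f q)` IS the normal form applied to `φ q` (the two coordinate identities
of Hayano 2011, Def. 2.1 (4) assembled into a vector identity). [cite: Hayano2011, Def. 2.1 (4)] -/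
theorem apply_eq_foldNormalForm_of_fold_chart
    (hmodel : ∀ q ∈ φ.source, (ψ (f q)) 0 = (φ q) 0 ∧
      (ψ (f q)) 1 = (φ q) 1 ^ 2 + (φ q) 2 ^ 2 - (φ q) 3 ^ 2)
    {q : X} (hq : q ∈ φ.source) : ψ (f q) = foldNF (φ q) := by
  obtain ⟨h0, h1⟩ := hmodel q hq
  ext i
  fin_cases i
  · simpa using h0
  · simpa using h1

omit [ChartedSpace (EuclideanSpace ℝ (Fin 4)) X] [IsManifold (𝓡 4) ∞ X] in
/-- **`ℓ ∘ f` read in a fold chart**: on `φ.target`,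
`(ℓ ∘ f) ∘ φ⁻¹ = (ℓ ∘ ψ⁻¹) ∘ N` with `N` the fold normal form. [cite: Hayano2011, Def. 2.1 (4)] -/
theorem comp_symm_eq_of_fold_chart (hmaps : Set.MapsTo f φ.source ψ.source)
    (hmodel : ∀ q ∈ φ.source, (ψ (f q)) 0 = (φ q) 0 ∧
      (ψ (f q)) 1 = (φ q) 1 ^ 2 + (φ q) 2 ^ 2 - (φ q) 3 ^ 2)
    {u : EuclideanSpace ℝ (Fin 4)} (hu : u ∈ φ.target) :
    ((ℓ ∘ f) ∘ φ.symm) u = ((ℓ ∘ ψ.symm) ∘ foldNF) u := by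
  have hq : φ.symm u ∈ φ.source := φ.map_target hu
  calc ((ℓ ∘ f) ∘ φ.symm) u = ℓ (f (φ.symm u)) := rfl
    _ = ℓ (ψ.symm (ψ (f (φ.symm u)))) := by rw [ψ.left_inv (hmaps hq)]
    _ = ℓ (ψ.symm (foldNF (φ (φ.symm u)))) := by
      rw [apply_eq_foldNormalForm_of_fold_chart hmodel hq]
    _ = ((ℓ ∘ ψ.symm) ∘ foldNF) u := by rw [φ.right_inv hu]; rfl

omit [ChartedSpace (EuclideanSpace ℝ (Fin 4)) X] [IsManifold (𝓡 4) ∞ X] in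
/-- Near a point of `φ.target` the two readings agree eventually (the target is open). [folklore] -/
theorem comp_symm_eventuallyEq_of_fold_chart (hmaps : Set.MapsTo f φ.source ψ.source)
    (hmodel : ∀ q ∈ φ.source, (ψ (f q)) 0 = (φ q) 0 ∧
      (ψ (f q)) 1 = (φ q) 1 ^ 2 + (φ q) 2 ^ 2 - (φ q) 3 ^ 2)
    {u : EuclideanSpace ℝ (Fin 4)} (hu : u ∈ φ.target) :
    ((ℓ ∘ f) ∘ φ.symm) =ᶠ[𝓝 u] ((ℓ ∘ ψ.symm) ∘ foldNF) :=
  Filter.eventuallyEq_of_mem (φ.open_target.mem_nhds hu)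
    fun _ hv => comp_symm_eq_of_fold_chart hmaps hmodel hv

/-- `ℓ ∘ ψ⁻¹` is `C^∞` (as a map of the plane) at every point of `ψ.target`, for `ℓ` smooth and
`ψ` a chart with smooth inverse. [folklore] -/
theorem contDiffAt_comp_symm_of_chart (hψs : ContMDiffOn (𝓡 2) (𝓡 2) ∞ ψ.symm ψ.target)
    (hℓ : ContMDiff (𝓡 2) 𝓘(ℝ, ℝ) ∞ ℓ) {y : EuclideanSpace ℝ (Fin 2)} (hy : y ∈ ψ.target) :
    ContDiffAt ℝ ∞ (ℓ ∘ ψ.symm) y := by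
  have h1 : ContMDiffAt (𝓡 2) (𝓡 2) ∞ ψ.symm y :=
    (hψs y hy).contMDiffAt (ψ.open_target.mem_nhds hy)
  have h2 : ContMDiffAt (𝓡 2) 𝓘(ℝ, ℝ) ∞ (ℓ ∘ ψ.symm) y := (hℓ _).comp y h1
  exact contMDiffAt_iff_contDiffAt.1 h2

/-- The fold chart `φ` (smooth with smooth inverse) belongs to the `C²` maximal atlas of `X`.
[folklore] -/
theorem mem_maximalAtlas_two_of_fold_chart (hφ : ContMDiffOn (𝓡 4) (𝓡 4) ∞ φ φ.source)
    (hφs : ContMDiffOn (𝓡 4) (𝓡 4) ∞ φ.symm φ.target) :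
    φ ∈ IsManifold.maximalAtlas (𝓡 4) 2 X :=
  OpenPartialHomeomorph.mem_maximalAtlas_of_contMDiffOn φ (hφ.of_le (by norm_cast))
    (hφs.of_le (by norm_cast))

omit [ChartedSpace (EuclideanSpace ℝ (Fin 4)) X] [IsManifold (𝓡 4) ∞ X] in
/-- **The Hessian of `ℓ ∘ f` read in a fold chart** is the second derivative of
`(ℓ ∘ ψ⁻¹) ∘ N` at `φ q`. [cite: Milnor1963, §2] -/
theorem hessianInChart_of_fold_chart (hmaps : Set.MapsTo f φ.source ψ.source)
    (hmodel : ∀ q ∈ φ.source, (ψ (f q)) 0 = (φ q) 0 ∧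
      (ψ (f q)) 1 = (φ q) 1 ^ 2 + (φ q) 2 ^ 2 - (φ q) 3 ^ 2)
    {q : X} (hq : q ∈ φ.source) (v w : EuclideanSpace ℝ (Fin 4)) :
    hessianInChart (𝓡 4) φ (ℓ ∘ f) q v w =
      fderiv ℝ (fderiv ℝ ((ℓ ∘ ψ.symm) ∘ foldNF)) (φ q) v w := by
  rw [hessianInChart_apply_apply]
  have hrange : range (𝓡 4) = univ := ModelWithCorners.Boundaryless.range_eq_univ
  simp only [hrange, fderivWithin_univ]
  have hext : (φ.extend (𝓡 4)) q = φ q := by simp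
  have hsymm : ((ℓ ∘ f) ∘ (φ.extend (𝓡 4)).symm) = ((ℓ ∘ f) ∘ φ.symm) := by
    funext u; simp
  rw [hext, hsymm,
    ((comp_symm_eventuallyEq_of_fold_chart hmaps hmodel (φ.map_source hq)).fderiv).fderiv_eq]

/-- **Critical points of `ℓ ∘ f` on the round locus, read in a fold chart** (Milnor 1963, §2 with
Hayano 2011, Def. 2.1 (4)).  At a point `q` of the axis of a fold chart (`(φ q)₁ = (φ q)₂ =
(φ q)₃ = 0`, i.e. a round point in the chart), `q` is a critical point of `ℓ ∘ f` iff
`∂ₜ (ℓ ∘ ψ⁻¹) = 0` at `ψ (f q)`: the round image is the curve `t ↦ ψ⁻¹ (t, 0)` and only the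
derivative of `ℓ` ALONG it matters. [cite: Milnor1963, §2] -/
theorem isMCriticalPt_comp_iff_of_fold_chart (hmaps : Set.MapsTo f φ.source ψ.source)
    (hφ : ContMDiffOn (𝓡 4) (𝓡 4) ∞ φ φ.source) (hφs : ContMDiffOn (𝓡 4) (𝓡 4) ∞ φ.symm φ.target)
    (hψs : ContMDiffOn (𝓡 2) (𝓡 2) ∞ ψ.symm ψ.target)
    (hmodel : ∀ q ∈ φ.source, (ψ (f q)) 0 = (φ q) 0 ∧
      (ψ (f q)) 1 = (φ q) 1 ^ 2 + (φ q) 2 ^ 2 - (φ q) 3 ^ 2)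
    (hf : ContMDiff (𝓡 4) (𝓡 2) ∞ f) (hℓ : ContMDiff (𝓡 2) 𝓘(ℝ, ℝ) ∞ ℓ)
    {q : X} (hq : q ∈ φ.source) (haxis : (φ q) 1 = 0 ∧ (φ q) 2 = 0 ∧ (φ q) 3 = 0) :
    IsMCriticalPt (𝓡 4) (ℓ ∘ f) q ↔
      fderiv ℝ (ℓ ∘ ψ.symm) (ψ (f q)) (EuclideanSpace.single (0 : Fin 2) (1 : ℝ)) = 0 := by
  have hg : ContMDiffAt (𝓡 4) 𝓘(ℝ, ℝ) 2 (ℓ ∘ f) q :=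
    ((hℓ _).comp q (hf q)).of_le (by norm_cast)
  rw [isMCriticalPt_iff_fderiv_comp_extend_symm_eq_zero hg
    (mem_maximalAtlas_two_of_fold_chart hφ hφs) hq]
  have hext : (φ.extend (𝓡 4)) q = φ q := by simp
  have hsymm : ((ℓ ∘ f) ∘ (φ.extend (𝓡 4)).symm) = ((ℓ ∘ f) ∘ φ.symm) := by
    funext u; simp
  rw [hext, hsymm, (comp_symm_eventuallyEq_of_fold_chart hmaps hmodel (φ.map_source hq)).fderiv_eq]
  have hN : ψ (f q) = foldNF (φ q) := apply_eq_foldNormalForm_of_fold_chart hmodel hq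
  have hΛ : DifferentiableAt ℝ (ℓ ∘ ψ.symm) (foldNF (φ q)) := by
    rw [← hN]
    exact (contDiffAt_comp_symm_of_chart hψs hℓ (ψ.map_source (hmaps hq))).differentiableAt
      (by simp)
  have key := fderiv_comp_foldNormalForm_apply hΛ haxis
  rw [hN]
  constructor
  · intro h
    have := key (EuclideanSpace.single (0 : Fin 4) (1 : ℝ))
    rw [h] at this
    simpa using this.symm
  · intro h
    ext w
    simp [key w, h]

/-- **Index and nondegeneracy of `ℓ ∘ f` at a critical round point, read in a fold chart**
(Milnor 1963, §2; Hayano 2011, Def. 2.1 (4)).  Let `q` be a point of the axis of a fold chart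
which is a critical point of `ℓ ∘ f`, and put `Λ = ℓ ∘ ψ⁻¹`, `α = ∂ₜₜΛ`, `β = ∂ₛΛ` at
`ψ (f q)` (second derivative along the round image, first derivative across it).  If `α ≠ 0`
and `β ≠ 0` then `q` is a nondegenerate critical point of `ℓ ∘ f` of index `[α < 0] + 1` when
`β > 0` and `[α < 0] + 2` when `β < 0` — the Hessian in the chart is the diagonal form
`(α, 2β, 2β, -2β)`. [cite: Milnor1963, §2] -/
theorem nondegenerate_and_morseIndex_comp_of_fold_chart (hmaps : Set.MapsTo f φ.source ψ.source)
    (hφ : ContMDiffOn (𝓡 4) (𝓡 4) ∞ φ φ.source) (hφs : ContMDiffOn (𝓡 4) (𝓡 4) ∞ φ.symm φ.target)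
    (hψs : ContMDiffOn (𝓡 2) (𝓡 2) ∞ ψ.symm ψ.target)
    (hmodel : ∀ q ∈ φ.source, (ψ (f q)) 0 = (φ q) 0 ∧
      (ψ (f q)) 1 = (φ q) 1 ^ 2 + (φ q) 2 ^ 2 - (φ q) 3 ^ 2)
    (hf : ContMDiff (𝓡 4) (𝓡 2) ∞ f) (hℓ : ContMDiff (𝓡 2) 𝓘(ℝ, ℝ) ∞ ℓ)
    {q : X} (hq : q ∈ φ.source) (haxis : (φ q) 1 = 0 ∧ (φ q) 2 = 0 ∧ (φ q) 3 = 0)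
    (hcrit : IsMCriticalPt (𝓡 4) (ℓ ∘ f) q)
    (hα : fderiv ℝ (fderiv ℝ (ℓ ∘ ψ.symm)) (ψ (f q)) (EuclideanSpace.single (0 : Fin 2) (1 : ℝ))
      (EuclideanSpace.single (0 : Fin 2) (1 : ℝ)) ≠ 0)
    (hβ : fderiv ℝ (ℓ ∘ ψ.symm) (ψ (f q)) (EuclideanSpace.single (1 : Fin 2) (1 : ℝ)) ≠ 0) :
    (mhessian (𝓡 4) (ℓ ∘ f) q).Nondegenerate ∧
      morseIndex (𝓡 4) (ℓ ∘ f) q =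
        (if fderiv ℝ (fderiv ℝ (ℓ ∘ ψ.symm)) (ψ (f q)) (EuclideanSpace.single (0 : Fin 2) (1 : ℝ))
            (EuclideanSpace.single (0 : Fin 2) (1 : ℝ)) < 0 then 1 else 0) +
        (if 0 < fderiv ℝ (ℓ ∘ ψ.symm) (ψ (f q)) (EuclideanSpace.single (1 : Fin 2) (1 : ℝ))
          then 1 else 2) := by
  have hg : ContMDiffAt (𝓡 4) 𝓘(ℝ, ℝ) 2 (ℓ ∘ f) q :=
    ((hℓ _).comp q (hf q)).of_le (by norm_cast)
  have he := mem_maximalAtlas_two_of_fold_chart hφ hφs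
  have hN : ψ (f q) = foldNF (φ q) := apply_eq_foldNormalForm_of_fold_chart hmodel hq
  have hΛ : ContDiffAt ℝ 2 (ℓ ∘ ψ.symm) (foldNF (φ q)) := by
    rw [← hN]
    exact (contDiffAt_comp_symm_of_chart hψs hℓ (ψ.map_source (hmaps hq))).of_le (by norm_cast)
  -- the Hessian in the chart is the diagonal form `(α, 2β, 2β, -2β)`
  have hform : ∀ v w, hessianInChart (𝓡 4) φ (ℓ ∘ f) q v w =
      fderiv ℝ (fderiv ℝ (ℓ ∘ ψ.symm)) (ψ (f q)) (EuclideanSpace.single (0 : Fin 2) (1 : ℝ))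
          (EuclideanSpace.single (0 : Fin 2) (1 : ℝ)) * (v 0 * w 0) +
        fderiv ℝ (ℓ ∘ ψ.symm) (ψ (f q)) (EuclideanSpace.single (1 : Fin 2) (1 : ℝ)) *
          (2 * (v 1 * w 1 + v 2 * w 2 - v 3 * w 3)) := fun v w => by
    rw [hessianInChart_of_fold_chart hmaps hmodel hq, fderiv_fderiv_comp_foldNormalForm_apply hΛ haxis,
      hN]
  constructor
  · rw [nondegenerate_mhessian_iff hg hcrit he hq,
      nondegenerate_iff_of_forall_apply_eq_foldForm _ hform]
    exact ⟨hα, hβ⟩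
  · rw [morseIndex_eq_sigNeg_hessianInChart hg hcrit he hq]
    exact sigNeg_of_forall_apply_eq_foldForm _ hα hβ hform

end FoldChart

section NodeChart

variable {X : Type*} [TopologicalSpace X] [ChartedSpace (EuclideanSpace ℝ (Fin 4)) X]
  [IsManifold (𝓡 4) ∞ X]
  {f : X → Metric.sphere (0 : EuclideanSpace ℝ (Fin 3)) 1}
  {ℓ : Metric.sphere (0 : EuclideanSpace ℝ (Fin 3)) 1 → ℝ} {p : X}

omit [IsManifold (𝓡 4) ∞ X] in
/-- **`ℓ ∘ f` read in a Lefschetz chart**: near `φ p = 0`,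
`(ℓ ∘ f) ∘ φ⁻¹ = (ℓ ∘ ψ⁻¹) ∘ (z₁ z₂)` (Gompf–Stipsicz 1999, Def. 8.1.4). [cite: GompfStipsiczGSM1999, Def. 8.1.4] -/
theorem comp_symm_eventuallyEq_of_lefschetzChart (c : LefschetzChart (𝓡 4) (𝓡 2) f p) :
    ((ℓ ∘ f) ∘ c.φ.symm) =ᶠ[𝓝 (c.φ p)] ((ℓ ∘ c.ψ.symm) ∘ lefschetzNodeMap) := by
  refine Filter.eventuallyEq_of_mem (c.φ.open_target.mem_nhds (c.φ.map_source c.mem_source))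
    fun u hu => ?_
  have hq : c.φ.symm u ∈ c.φ.source := c.φ.map_target hu
  simp only [Function.comp_apply]
  rw [c.apply_eq hq, c.φ.right_inv hu]

/-- **A Lefschetz point is a nondegenerate critical point of index `2` of `ℓ ∘ f` whenever `ℓ`
is regular at the critical value** (Milnor 1963, §2 in the chart of Gompf–Stipsicz 1999,
Def. 8.1.4: the Hessian of `ℓ ∘ f` at `p` is `dℓ ∘ D²(z₁ z₂)`, the real part of a nonzero complex
multiple of `z₁ z₂`, of signature `(2, 2)`).  Here `f : X → S²` is `C^∞` on the 4-manifold `X`,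
`c` a Lefschetz chart of `f` at `p`, `ℓ : S² → ℝ` smooth with `dℓ_{f p} ≠ 0`.
[cite: Milnor1963, §2] -/
theorem isMCriticalPt_nondegenerate_morseIndex_comp_of_lefschetzChart
    (c : LefschetzChart (𝓡 4) (𝓡 2) f p) (hf : ContMDiff (𝓡 4) (𝓡 2) ∞ f)
    (hℓ : ContMDiff (𝓡 2) 𝓘(ℝ, ℝ) ∞ ℓ) (hℓp : mfderiv (𝓡 2) 𝓘(ℝ, ℝ) ℓ (f p) ≠ 0) :
    IsMCriticalPt (𝓡 4) (ℓ ∘ f) p ∧ (mhessian (𝓡 4) (ℓ ∘ f) p).Nondegenerate ∧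
      morseIndex (𝓡 4) (ℓ ∘ f) p = 2 := by
  -- `p` is critical: `d(ℓ ∘ f)_p = dℓ ∘ df_p = 0`
  have hcrit : IsMCriticalPt (𝓡 4) (ℓ ∘ f) p := by
    unfold IsMCriticalPt
    rw [mfderiv_comp p ((hℓ _).mdifferentiableAt (by simp)) ((hf p).mdifferentiableAt (by simp)),
      c.mfderiv_eq_zero, ContinuousLinearMap.comp_zero]
    rfl
  have hg : ContMDiffAt (𝓡 4) 𝓘(ℝ, ℝ) 2 (ℓ ∘ f) p :=
    ((hℓ _).comp p (hf p)).of_le (by norm_cast)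
  have he : c.φ ∈ IsManifold.maximalAtlas (𝓡 4) 2 X :=
    OpenPartialHomeomorph.mem_maximalAtlas_of_contMDiffOn c.φ (c.contMDiffOn.of_le (by norm_cast))
      (c.contMDiffOn_symm.of_le (by norm_cast))
  -- `Λ = ℓ ∘ ψ⁻¹` is smooth at `0 = ψ (f p)` and `μ = dΛ_0 ≠ 0`
  have h0 : c.ψ (f p) = 0 := c.base_apply_eq_zero
  have hψsymm : ContMDiffAt 𝓘(ℝ, ℂ) (𝓡 2) ∞ c.ψ.symm 0 := by
    rw [← h0]; exact c.contMDiffAt_base_symm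
  have hΛ' : ContMDiffAt 𝓘(ℝ, ℂ) 𝓘(ℝ, ℝ) ∞ (ℓ ∘ c.ψ.symm) 0 := (hℓ _).comp (0 : ℂ) hψsymm
  have hΛ : ContDiffAt ℝ 2 (ℓ ∘ c.ψ.symm) (lefschetzNodeMap 0) := by
    rw [lefschetzNodeMap_zero]
    exact (contMDiffAt_iff_contDiffAt.1 hΛ').of_le (by norm_cast)
  have hμ : fderiv ℝ (ℓ ∘ c.ψ.symm) 0 ≠ 0 := by
    intro hzero
    apply hℓp
    -- `dΛ_0 = dℓ_{f p} ∘ d(ψ⁻¹)_0` with `d(ψ⁻¹)_0` onto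
    have hψd : c.ψ.MDifferentiable (𝓡 2) 𝓘(ℝ, ℂ) :=
      ⟨c.contMDiffOn_base.mdifferentiableOn (by simp), c.contMDiffOn_base_symm.mdifferentiableOn (by simp)⟩
    have hsurj : Surjective (mfderiv 𝓘(ℝ, ℂ) (𝓡 2) c.ψ.symm 0) := by
      rw [← h0]
      exact hψd.symm.mfderiv_surjective (c.ψ.map_source c.apply_mem_source)
    have hcomp : mfderiv 𝓘(ℝ, ℂ) 𝓘(ℝ, ℝ) (ℓ ∘ c.ψ.symm) 0 =
        (mfderiv (𝓡 2) 𝓘(ℝ, ℝ) ℓ (f p)).comp (mfderiv 𝓘(ℝ, ℂ) (𝓡 2) c.ψ.symm 0) := by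
      have hsp : c.ψ.symm 0 = f p := by rw [← h0, c.ψ.left_inv c.apply_mem_source]
      rw [mfderiv_comp (0 : ℂ) (by rw [hsp]; exact (hℓ _).mdifferentiableAt (by simp))
        (hψsymm.mdifferentiableAt (by simp)), hsp]
    have hm0 : mfderiv 𝓘(ℝ, ℂ) 𝓘(ℝ, ℝ) (ℓ ∘ c.ψ.symm) 0 = 0 := by
      rw [mfderiv_eq_fderiv]; exact hzero
    rw [hm0] at hcomp
    ext y
    obtain ⟨v, rfl⟩ := hsurj y
    exact (DFunLike.congr_fun hcomp v).symm
  -- the Hessian in the chart is `μ (z₁ v z₂ w + z₁ w z₂ v)`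
  have hform : ∀ v w, hessianInChart (𝓡 4) c.φ (ℓ ∘ f) p v w =
      fderiv ℝ (ℓ ∘ c.ψ.symm) 0 ((⟨v 0, v 1⟩ : ℂ) * ⟨w 2, w 3⟩ + ⟨w 0, w 1⟩ * ⟨v 2, v 3⟩) := by
    intro v w
    rw [hessianInChart_apply_apply]
    have hrange : range (𝓡 4) = univ := ModelWithCorners.Boundaryless.range_eq_univ
    simp only [hrange, fderivWithin_univ]
    have hext : (c.φ.extend (𝓡 4)) p = c.φ p := by simp
    have hsymm : ((ℓ ∘ f) ∘ (c.φ.extend (𝓡 4)).symm) = ((ℓ ∘ f) ∘ c.φ.symm) := by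
      funext u; simp
    rw [hext, hsymm, ((comp_symm_eventuallyEq_of_lefschetzChart c).fderiv).fderiv_eq, c.apply_eq_zero,
      fderiv_fderiv_comp_lefschetzNodeMap_apply hΛ]
  refine ⟨hcrit, ?_, ?_⟩
  · rw [nondegenerate_mhessian_iff hg hcrit he c.mem_source]
    exact nondegenerate_of_forall_apply_eq_nodeForm _ hμ hform
  · rw [morseIndex_eq_sigNeg_hessianInChart hg hcrit he c.mem_source]
    exact sigNeg_of_forall_apply_eq_nodeForm _ hμ hform

end NodeChart

end Literature.Topology.FourManifolds
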